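import Summits.KontsevichZagierPeriods.KontsevichZagierPeriods.Theorems.RootDecompZetaThreeFrontierGZLadderFourPolarP01

/-! # `RootDecompZetaThreeFrontierGZLadderFourPolarP02` — part 2/12 of the mechanical ≤400-line split of `l4_src.lean` (sha256 5cc5a9ee4c47da9a…)
Source: decomp-kz lens-1 g13 Layer4_v1.lean @897236f9 minus the RungFour prelude block (imported from …RungFourPreludeP14); --supports stmt-KontsevichZagierPeriods-27141.
Split by census-1 g10 `gen/splitlean.py`: scopes re-opened with their `open`/`variable`/`set_option` context; mathematics and declaration order unchanged. -/

set_option linter.dupNamespace false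
noncomputable section
set_option linter.dupNamespace false
set_option linter.unusedVariables false
set_option linter.unusedSectionVars false
set_option linter.unusedSimpArgs false
open Set MeasureTheory MvPolynomial
open Literature.NumberTheory.Transcendental
open Summit.KontsevichZagierPeriods.KontsevichZagierPeriods.Theorems.RootDecompZetaThreeFrontierWordMoves
namespace Summit.KontsevichZagierPeriods.KontsevichZagierPeriods.Cruxes.GZNormalFormWThree.GZLadder.WlogFour

open Set MeasureTheory MvPolynomial in
open Literature.NumberTheory.Transcendental in
open Summit.KontsevichZagierPeriods.KontsevichZagierPeriods.Theorems.RootDecompZetaThreeFrontierWordMoves in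
/-- Auxiliary step `mem_simplex_four_iff` (§W5): mem simplex four iff. [bookkeeping] -/
private theorem mem_simplex_four_iff (t : Fin 4 → ℝ) :
    t ∈ KZ.openOrderedSimplex 4 ↔ 0 < t 3 ∧ t 3 < t 2 ∧ t 2 < t 1 ∧ t 1 < t 0 ∧ t 0 < 1 := by
  constructor
  · rintro ⟨h0, h1, ha⟩
    exact ⟨h0 3, ha (show (2 : Fin 4) < 3 by decide), ha (show (1 : Fin 4) < 2 by decide),
      ha (show (0 : Fin 4) < 1 by decide), h1 0⟩
  · rintro ⟨h3, h32, h21, h10, h0⟩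
    have hsa : StrictAnti t := by
      refine Fin.strictAnti_iff_succ_lt.mpr fun i => ?_
      fin_cases i
      · simpa using h10
      · simpa using h21
      · simpa using h32
    exact ⟨fun i => lt_of_lt_of_le h3 (hsa.antitone (Fin.le_last i)),
      fun i => lt_of_le_of_lt (hsa.antitone (Fin.le_iff_val_le_val.2 (Nat.zero_le _))) h0, hsa⟩

open Set MeasureTheory MvPolynomial in
open Literature.NumberTheory.Transcendental in
open Summit.KontsevichZagierPeriods.KontsevichZagierPeriods.Theorems.RootDecompZetaThreeFrontierWordMoves in
/-- Auxiliary step `abs_det_of_invol4` (§W4): abs det of invol4. [bookkeeping] -/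
private theorem abs_det_of_invol4 {L : (Fin 4 → ℝ) →L[ℝ] (Fin 4 → ℝ)} (h : ∀ w, L (L w) = w) : |L.det| = 1 := by
  have hcomp : (L : (Fin 4 → ℝ) →ₗ[ℝ] (Fin 4 → ℝ)) ∘ₗ (L : (Fin 4 → ℝ) →ₗ[ℝ] (Fin 4 → ℝ)) = LinearMap.id := by
    apply LinearMap.ext
    intro w
    simp [h]
  have h1 := congrArg LinearMap.det hcomp
  rw [LinearMap.det_comp, LinearMap.det_id] at h1
  have h2 : |LinearMap.det (L : (Fin 4 → ℝ) →ₗ[ℝ] (Fin 4 → ℝ))| ^ 2 = 1 := by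
    rw [sq_abs, sq, h1]
  exact (pow_eq_one_iff_of_nonneg (abs_nonneg _) two_ne_zero).1 h2

/-- Auxiliary step `s13_zero`: s13 zero. [bookkeeping] -/
theorem s13_zero (z : Fin 4 → ℝ) : s13 z 0 = z 0 := by simp [s13]
/-- Auxiliary step `s13_one`: s13 one. [bookkeeping] -/
theorem s13_one (z : Fin 4 → ℝ) : s13 z 1 = z 1 := by simp [s13]
/-- Auxiliary step `s13_two`: s13 two. [bookkeeping] -/
theorem s13_two (z : Fin 4 → ℝ) : s13 z 2 = z 1 - z 3 := by simp [s13]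
/-- Auxiliary step `s13_three`: s13 three. [bookkeeping] -/
theorem s13_three (z : Fin 4 → ℝ) : s13 z 3 = z 1 - z 2 := by simp [s13]

/-- Auxiliary step `s13_eq_L`: s13 eq L. [bookkeeping] -/
theorem s13_eq_L (z : Fin 4 → ℝ) : s13 z = s13L z := by
  funext i
  fin_cases i <;> simp [s13, s13L]

/-- Auxiliary step `s13_s13`: s13 s13. [bookkeeping] -/
theorem s13_s13 (z : Fin 4 → ℝ) : s13 (s13 z) = z := by
  funext i
  fin_cases i <;> simp [s13_zero, s13_one, s13_two, s13_three]

/-- Auxiliary step `s13L_s13L`: s13 L s13 L. [bookkeeping] -/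
theorem s13L_s13L (w : Fin 4 → ℝ) : s13L (s13L w) = w := by
  rw [← s13_eq_L, ← s13_eq_L, s13_s13]

/-- Auxiliary step `hasFDerivAt_s13`: has FDeriv At s13. [bookkeeping] -/
theorem hasFDerivAt_s13 (x : Fin 4 → ℝ) : HasFDerivAt s13 s13L x := by
  have e : s13 = fun z => s13L z := funext s13_eq_L
  rw [e]
  exact s13L.hasFDerivAt

/-- Auxiliary step `abs_det_s13L`: abs det s13 L. [bookkeeping] -/
theorem abs_det_s13L : |s13L.det| = 1 := abs_det_of_invol4 s13L_s13L

/-- Auxiliary step `mem_simplex_four_s13`: mem simplex four s13. [bookkeeping] -/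
theorem mem_simplex_four_s13 {z : Fin 4 → ℝ} (hz : z ∈ KZ.openOrderedSimplex 4) : s13 z ∈ KZ.openOrderedSimplex 4 := by
  rw [mem_simplex_four_iff] at hz ⊢
  rw [s13_zero, s13_one, s13_two, s13_three]; obtain ⟨h3, h32, h21, h10, h0⟩ := hz; exact ⟨by linarith, by linarith, by linarith, by linarith, by linarith⟩

/-- `F` integrable on `Δ₄` ⟹ `F ∘ s13` integrable on `Δ₄` -/
theorem integrableOn_comp_s13 {F : (Fin 4 → ℝ) → ℝ} (hF : IntegrableOn F (KZ.openOrderedSimplex 4)) :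
    IntegrableOn (fun z => F (s13 z)) (KZ.openOrderedSimplex 4) :=
  integrableOn_comp_invol4 hasFDerivAt_s13 abs_det_s13L s13_s13 (fun _ hz => mem_simplex_four_s13 hz) hF

/-- the substitution `P ↦ P ∘ s13` on polynomials -/
def s13P : MvPolynomial (Fin 4) ℚ →ₐ[ℚ] MvPolynomial (Fin 4) ℚ :=
  MvPolynomial.bind₁ ![MvPolynomial.X 0, MvPolynomial.X 1, MvPolynomial.X 1 - MvPolynomial.X 3, MvPolynomial.X 1 - MvPolynomial.X 2]

/-- Auxiliary step `s13P_s13P`: s13 P s13 P. [bookkeeping] -/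
theorem s13P_s13P (p : MvPolynomial (Fin 4) ℚ) : s13P (s13P p) = p := by
  have h : s13P.comp s13P = AlgHom.id ℚ _ := MvPolynomial.algHom_ext fun i => by
    fin_cases i <;> simp [s13P, MvPolynomial.bind₁_X_right, sub_sub_cancel]
  exact AlgHom.congr_fun h p

/-- Auxiliary step `aeval_s13P`: aeval s13 P. [bookkeeping] -/
theorem aeval_s13P (p : MvPolynomial (Fin 4) ℚ) (t : Fin 4 → ℝ) :
    MvPolynomial.aeval t (s13P p) = MvPolynomial.aeval (s13 t) p := by
  have e : (fun i => MvPolynomial.aeval t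
      ((![MvPolynomial.X 0, MvPolynomial.X 1, MvPolynomial.X 1 - MvPolynomial.X 3, MvPolynomial.X 1 - MvPolynomial.X 2] :
        Fin 4 → MvPolynomial (Fin 4) ℚ) i)) = s13 t := by
    funext i
    fin_cases i <;> simp [s13_zero, s13_one, s13_two, s13_three]
  rw [s13P, MvPolynomial.aeval_bind₁, e]

/-- `τ₀₁(t) = (t₀, t₀ - t₃, t₀ - t₂, t₀ - t₁)` (exchanges the faces `t₃ = 0` and `t₀ = t₁`) -/
def s03 (z : Fin 4 → ℝ) : Fin 4 → ℝ := ![z 0, z 0 - z 3, z 0 - z 2, z 0 - z 1]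
/-- its linear part -/
def s03L : (Fin 4 → ℝ) →L[ℝ] (Fin 4 → ℝ) := ContinuousLinearMap.pi ![Pj4 0, Pj4 0 - Pj4 3, Pj4 0 - Pj4 2, Pj4 0 - Pj4 1]

/-- Auxiliary step `s03_zero`: s03 zero. [bookkeeping] -/
theorem s03_zero (z : Fin 4 → ℝ) : s03 z 0 = z 0 := by simp [s03]
/-- Auxiliary step `s03_one`: s03 one. [bookkeeping] -/
theorem s03_one (z : Fin 4 → ℝ) : s03 z 1 = z 0 - z 3 := by simp [s03]
/-- Auxiliary step `s03_two`: s03 two. [bookkeeping] -/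
theorem s03_two (z : Fin 4 → ℝ) : s03 z 2 = z 0 - z 2 := by simp [s03]
/-- Auxiliary step `s03_three`: s03 three. [bookkeeping] -/
theorem s03_three (z : Fin 4 → ℝ) : s03 z 3 = z 0 - z 1 := by simp [s03]

/-- Auxiliary step `s03_eq_L`: s03 eq L. [bookkeeping] -/
theorem s03_eq_L (z : Fin 4 → ℝ) : s03 z = s03L z := by
  funext i
  fin_cases i <;> simp [s03, s03L]

/-- Auxiliary step `s03_s03`: s03 s03. [bookkeeping] -/
theorem s03_s03 (z : Fin 4 → ℝ) : s03 (s03 z) = z := by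
  funext i
  fin_cases i <;> simp [s03_zero, s03_one, s03_two, s03_three]

/-- Auxiliary step `s03L_s03L`: s03 L s03 L. [bookkeeping] -/
theorem s03L_s03L (w : Fin 4 → ℝ) : s03L (s03L w) = w := by
  rw [← s03_eq_L, ← s03_eq_L, s03_s03]

/-- Auxiliary step `hasFDerivAt_s03`: has FDeriv At s03. [bookkeeping] -/
theorem hasFDerivAt_s03 (x : Fin 4 → ℝ) : HasFDerivAt s03 s03L x := by
  have e : s03 = fun z => s03L z := funext s03_eq_L
  rw [e]; exact s03L.hasFDerivAt

/-- Auxiliary step `abs_det_s03L`: abs det s03 L. [bookkeeping] -/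
theorem abs_det_s03L : |s03L.det| = 1 := abs_det_of_invol4 s03L_s03L

/-- Auxiliary step `mem_simplex_four_s03`: mem simplex four s03. [bookkeeping] -/
theorem mem_simplex_four_s03 {z : Fin 4 → ℝ} (hz : z ∈ KZ.openOrderedSimplex 4) : s03 z ∈ KZ.openOrderedSimplex 4 := by
  rw [mem_simplex_four_iff] at hz ⊢
  rw [s03_zero, s03_one, s03_two, s03_three]; obtain ⟨h3, h32, h21, h10, h0⟩ := hz; exact ⟨by linarith, by linarith, by linarith, by linarith, by linarith⟩

/-- `F` integrable on `Δ₄` ⟹ `F ∘ s03` integrable on `Δ₄` -/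
theorem integrableOn_comp_s03 {F : (Fin 4 → ℝ) → ℝ} (hF : IntegrableOn F (KZ.openOrderedSimplex 4)) :
    IntegrableOn (fun z => F (s03 z)) (KZ.openOrderedSimplex 4) :=
  integrableOn_comp_invol4 hasFDerivAt_s03 abs_det_s03L s03_s03 (fun _ hz => mem_simplex_four_s03 hz) hF

/-- the substitution `P ↦ P ∘ s03` on polynomials -/
def s03P : MvPolynomial (Fin 4) ℚ →ₐ[ℚ] MvPolynomial (Fin 4) ℚ :=
  MvPolynomial.bind₁ ![MvPolynomial.X 0, MvPolynomial.X 0 - MvPolynomial.X 3, MvPolynomial.X 0 - MvPolynomial.X 2, MvPolynomial.X 0 - MvPolynomial.X 1]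

/-- Auxiliary step `s03P_s03P`: s03 P s03 P. [bookkeeping] -/
theorem s03P_s03P (p : MvPolynomial (Fin 4) ℚ) : s03P (s03P p) = p := by
  have h : s03P.comp s03P = AlgHom.id ℚ _ := MvPolynomial.algHom_ext fun i => by
    fin_cases i <;> simp [s03P, MvPolynomial.bind₁_X_right, sub_sub_cancel]
  exact AlgHom.congr_fun h p

/-- Auxiliary step `aeval_s03P`: aeval s03 P. [bookkeeping] -/
theorem aeval_s03P (p : MvPolynomial (Fin 4) ℚ) (t : Fin 4 → ℝ) :
    MvPolynomial.aeval t (s03P p) = MvPolynomial.aeval (s03 t) p := by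
  have e : (fun i => MvPolynomial.aeval t
      ((![MvPolynomial.X 0, MvPolynomial.X 0 - MvPolynomial.X 3, MvPolynomial.X 0 - MvPolynomial.X 2, MvPolynomial.X 0 - MvPolynomial.X 1] :
        Fin 4 → MvPolynomial (Fin 4) ℚ) i)) = s03 t := by
    funext i
    fin_cases i <;> simp [s03_zero, s03_one, s03_two, s03_three]
  rw [s03P, MvPolynomial.aeval_bind₁, e]

/-- the duality `σ₄(t) = (1 - t₃, 1 - t₂, 1 - t₁, 1 - t₀)` (exchanges the faces `t₃ = 0` and `t₀ = 1`) -/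
def du4 (z : Fin 4 → ℝ) : Fin 4 → ℝ := ![1 - z 3, 1 - z 2, 1 - z 1, 1 - z 0]
/-- its linear part -/
def du4L : (Fin 4 → ℝ) →L[ℝ] (Fin 4 → ℝ) := ContinuousLinearMap.pi ![-Pj4 3, -Pj4 2, -Pj4 1, -Pj4 0]

/-- Auxiliary step `du4_zero`: du4 zero. [bookkeeping] -/
theorem du4_zero (z : Fin 4 → ℝ) : du4 z 0 = 1 - z 3 := by simp [du4]
/-- Auxiliary step `du4_one`: du4 one. [bookkeeping] -/
theorem du4_one (z : Fin 4 → ℝ) : du4 z 1 = 1 - z 2 := by simp [du4]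
/-- Auxiliary step `du4_two`: du4 two. [bookkeeping] -/
theorem du4_two (z : Fin 4 → ℝ) : du4 z 2 = 1 - z 1 := by simp [du4]
/-- Auxiliary step `du4_three`: du4 three. [bookkeeping] -/
theorem du4_three (z : Fin 4 → ℝ) : du4 z 3 = 1 - z 0 := by simp [du4]

/-- Auxiliary step `du4_eq`: du4 eq. [bookkeeping] -/
theorem du4_eq (z : Fin 4 → ℝ) : du4 z = (fun _ => (1 : ℝ)) + du4L z := by
  funext i
  fin_cases i <;> simp [du4, du4L] <;> ring

/-- Auxiliary step `du4_du4`: du4 du4. [bookkeeping] -/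
theorem du4_du4 (z : Fin 4 → ℝ) : du4 (du4 z) = z := by
  funext i
  fin_cases i <;> simp [du4_zero, du4_one, du4_two, du4_three]

/-- Auxiliary step `hasFDerivAt_du4`: has FDeriv At du4. [bookkeeping] -/
theorem hasFDerivAt_du4 (x : Fin 4 → ℝ) : HasFDerivAt du4 du4L x := by
  have h : HasFDerivAt (fun z : Fin 4 → ℝ => (fun _ => (1 : ℝ)) + du4L z) du4L x := (du4L.hasFDerivAt).const_add _
  have e : du4 = fun z : Fin 4 → ℝ => (fun _ => (1 : ℝ)) + du4L z := funext du4_eq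
  rw [e]; exact h

/-- Auxiliary step `du4L_du4L`: du4 L du4 L. [bookkeeping] -/
theorem du4L_du4L (w : Fin 4 → ℝ) : du4L (du4L w) = w := by
  funext i
  fin_cases i <;> simp [du4L]

/-- Auxiliary step `abs_det_du4L`: abs det du4 L. [bookkeeping] -/
theorem abs_det_du4L : |du4L.det| = 1 := abs_det_of_invol4 du4L_du4L

/-- Auxiliary step `mem_simplex_four_du4`: mem simplex four du4. [bookkeeping] -/
theorem mem_simplex_four_du4 {z : Fin 4 → ℝ} (hz : z ∈ KZ.openOrderedSimplex 4) : du4 z ∈ KZ.openOrderedSimplex 4 := by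
  rw [mem_simplex_four_iff] at hz ⊢
  rw [du4_zero, du4_one, du4_two, du4_three]; obtain ⟨h3, h32, h21, h10, h0⟩ := hz; exact ⟨by linarith, by linarith, by linarith, by linarith, by linarith⟩

/-- `F` integrable on `Δ₄` ⟹ `F ∘ du4` integrable on `Δ₄` -/
theorem integrableOn_comp_du4 {F : (Fin 4 → ℝ) → ℝ} (hF : IntegrableOn F (KZ.openOrderedSimplex 4)) :
    IntegrableOn (fun z => F (du4 z)) (KZ.openOrderedSimplex 4) :=
  integrableOn_comp_invol4 hasFDerivAt_du4 abs_det_du4L du4_du4 (fun _ hz => mem_simplex_four_du4 hz) hF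

/-- the substitution `P ↦ P ∘ du4` on polynomials -/
def du4P : MvPolynomial (Fin 4) ℚ →ₐ[ℚ] MvPolynomial (Fin 4) ℚ :=
  MvPolynomial.bind₁ ![MvPolynomial.C 1 - MvPolynomial.X 3, MvPolynomial.C 1 - MvPolynomial.X 2, MvPolynomial.C 1 - MvPolynomial.X 1, MvPolynomial.C 1 - MvPolynomial.X 0]

/-- Auxiliary step `du4P_du4P`: du4 P du4 P. [bookkeeping] -/
theorem du4P_du4P (p : MvPolynomial (Fin 4) ℚ) : du4P (du4P p) = p := by
  have h : du4P.comp du4P = AlgHom.id ℚ _ := MvPolynomial.algHom_ext fun i => by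
    fin_cases i <;> simp [du4P, MvPolynomial.bind₁_X_right, sub_sub_cancel]
  exact AlgHom.congr_fun h p

/-- Auxiliary step `aeval_du4P`: aeval du4 P. [bookkeeping] -/
theorem aeval_du4P (p : MvPolynomial (Fin 4) ℚ) (t : Fin 4 → ℝ) :
    MvPolynomial.aeval t (du4P p) = MvPolynomial.aeval (du4 t) p := by
  have e : (fun i => MvPolynomial.aeval t
      ((![MvPolynomial.C 1 - MvPolynomial.X 3, MvPolynomial.C 1 - MvPolynomial.X 2, MvPolynomial.C 1 - MvPolynomial.X 1, MvPolynomial.C 1 - MvPolynomial.X 0] :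
        Fin 4 → MvPolynomial (Fin 4) ℚ) i)) = du4 t := by
    funext i
    fin_cases i <;> simp [du4_zero, du4_one, du4_two, du4_three]
  rw [du4P, MvPolynomial.aeval_bind₁, e]

/-! ## §W7 The genus-zero integrand of dimension 4, the five faces, the reduced form -/

/-- the genus-zero integrand of dimension `4`: `P / (∏ tᵢ^{bᵢ} ∏ (1-tᵢ)^{cᵢ} ∏_{i<j} (tᵢ-tⱼ)^{aᵢⱼ})`, fourteen exponents -/
def gzf4 (p : MvPolynomial (Fin 4) ℚ) (b₀ b₁ b₂ b₃ c₀ c₁ c₂ c₃ a₀₁ a₀₂ a₀₃ a₁₂ a₁₃ a₂₃ : ℕ) (t : Fin 4 → ℝ) : ℝ :=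
  MvPolynomial.aeval t p / (t 0 ^ b₀ * t 1 ^ b₁ * t 2 ^ b₂ * t 3 ^ b₃ * (1 - t 0) ^ c₀ * (1 - t 1) ^ c₁ * (1 - t 2) ^ c₂ * (1 - t 3) ^ c₃ * (t 0 - t 1) ^ a₀₁ * (t 0 - t 2) ^ a₀₂ * (t 0 - t 3) ^ a₀₃ * (t 1 - t 2) ^ a₁₂ * (t 1 - t 3) ^ a₁₃ * (t 2 - t 3) ^ a₂₃)

/-- **face 1** (`b₃`): integrability forces the factor with exponent `b₃` to cancel (directly: it is the last coordinate) -/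
theorem face4_1 (p : MvPolynomial (Fin 4) ℚ) (b₀ b₁ b₂ b₃ c₀ c₁ c₂ c₃ a₀₁ a₀₂ a₀₃ a₁₂ a₁₃ a₂₃ : ℕ)
    (hint : IntegrableOn (gzf4 p b₀ b₁ b₂ b₃ c₀ c₁ c₂ c₃ a₀₁ a₀₂ a₀₃ a₁₂ a₁₃ a₂₃) (KZ.openOrderedSimplex 4)) :
    ∃ p' : MvPolynomial (Fin 4) ℚ, EqOn (gzf4 p b₀ b₁ b₂ b₃ c₀ c₁ c₂ c₃ a₀₁ a₀₂ a₀₃ a₁₂ a₁₃ a₂₃) (gzf4 p' b₀ b₁ b₂ 0 c₀ c₁ c₂ c₃ a₀₁ a₀₂ a₀₃ a₁₂ a₁₃ a₂₃) (KZ.openOrderedSimplex 4) := by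
  have hsupp : ∀ e ∈ p.support, b₃ ≤ e 3 := by
    refine face_lemma4 (measurableSet_simplex 4) (fun y hy => (gz4_denoms_pos hy).2.2.2.1.ne')
      (KZ.isOpen_openOrderedSimplex 3) simplex_three_nonempty (fun x => x 2) (fun x hx => snoc_section_four hx)
      (fun x hx => section_base hx)
      (fun u => u 0 ^ b₀ * u 1 ^ b₁ * u 2 ^ b₂ * (1 - u 0) ^ c₀ * (1 - u 1) ^ c₁ * (1 - u 2) ^ c₂ * (1 - u 3) ^ c₃ * (u 0 - u 1) ^ a₀₁ * (u 0 - u 2) ^ a₀₂ * (u 0 - u 3) ^ a₀₃ * (u 1 - u 2) ^ a₁₂ * (u 1 - u 3) ^ a₁₃ * (u 2 - u 3) ^ a₂₃)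
      (fun x _ => ?_) (fun x hx => ?_) b₃ p
      (hint.congr_fun (fun u hu => ?_) (measurableSet_simplex 4))
    · show ContinuousAt (fun s : ℝ => x 0 ^ b₀ * x 1 ^ b₁ * x 2 ^ b₂ * (1 - x 0) ^ c₀ * (1 - x 1) ^ c₁ * (1 - x 2) ^ c₂ * (1 - (s)) ^ c₃ * (x 0 - x 1) ^ a₀₁ * (x 0 - x 2) ^ a₀₂ * (x 0 - (s)) ^ a₀₃ * (x 1 - x 2) ^ a₁₂ * (x 1 - (s)) ^ a₁₃ * (x 2 - (s)) ^ a₂₃) 0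
      exact (by fun_prop : Continuous fun s : ℝ => x 0 ^ b₀ * x 1 ^ b₁ * x 2 ^ b₂ * (1 - x 0) ^ c₀ * (1 - x 1) ^ c₁ * (1 - x 2) ^ c₂ * (1 - (s)) ^ c₃ * (x 0 - x 1) ^ a₀₁ * (x 0 - x 2) ^ a₀₂ * (x 0 - (s)) ^ a₀₃ * (x 1 - x 2) ^ a₁₂ * (x 1 - (s)) ^ a₁₃ * (x 2 - (s)) ^ a₂₃).continuousAt
    · obtain ⟨f0, f1, f2, f3, f4, f5, f6, f7, f8⟩ := gz3_denoms_pos hx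
      show x 0 ^ b₀ * x 1 ^ b₁ * x 2 ^ b₂ * (1 - x 0) ^ c₀ * (1 - x 1) ^ c₁ * (1 - x 2) ^ c₂ * (1 - ((0:ℝ))) ^ c₃ * (x 0 - x 1) ^ a₀₁ * (x 0 - x 2) ^ a₀₂ * (x 0 - ((0:ℝ))) ^ a₀₃ * (x 1 - x 2) ^ a₁₂ * (x 1 - ((0:ℝ))) ^ a₁₃ * (x 2 - ((0:ℝ))) ^ a₂₃ ≠ 0
      have : (0:ℝ) < (1 - x 0) := by linarith
      have : (0:ℝ) < (1 - x 1) := by linarith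
      have : (0:ℝ) < (1 - x 2) := by linarith
      have : (0:ℝ) < (1 - ((0:ℝ))) := by linarith
      have : (0:ℝ) < (x 0 - x 1) := by linarith
      have : (0:ℝ) < (x 0 - x 2) := by linarith
      have : (0:ℝ) < (x 0 - ((0:ℝ))) := by linarith
      have : (0:ℝ) < (x 1 - x 2) := by linarith
      have : (0:ℝ) < (x 1 - ((0:ℝ))) := by linarith
      have : (0:ℝ) < (x 2 - ((0:ℝ))) := by linarith
      positivity
    · obtain ⟨g0, g1, g2, g3, g4, g5, g6, g7, g8, g9, g10, g11, g12, g13⟩ := gz4_denoms_pos hu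
      have : (0:ℝ) < (1 - u 0) := by linarith
      have : (0:ℝ) < (1 - u 1) := by linarith
      have : (0:ℝ) < (1 - u 2) := by linarith
      have : (0:ℝ) < (1 - u 3) := by linarith
      have : (0:ℝ) < (u 0 - u 1) := by linarith
      have : (0:ℝ) < (u 0 - u 2) := by linarith
      have : (0:ℝ) < (u 0 - u 3) := by linarith
      have : (0:ℝ) < (u 1 - u 2) := by linarith
      have : (0:ℝ) < (u 1 - u 3) := by linarith
      have : (0:ℝ) < (u 2 - u 3) := by linarith
      show gzf4 p b₀ b₁ b₂ b₃ c₀ c₁ c₂ c₃ a₀₁ a₀₂ a₀₃ a₁₂ a₁₃ a₂₃ u = MvPolynomial.aeval u p / (u 3 ^ b₃ * (u 0 ^ b₀ * u 1 ^ b₁ * u 2 ^ b₂ * (1 - u 0) ^ c₀ * (1 - u 1) ^ c₁ * (1 - u 2) ^ c₂ * (1 - u 3) ^ c₃ * (u 0 - u 1) ^ a₀₁ * (u 0 - u 2) ^ a₀₂ * (u 0 - u 3) ^ a₀₃ * (u 1 - u 2) ^ a₁₂ * (u 1 - u 3) ^ a₁₃ * (u 2 - u 3) ^ a₂₃))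
      simp only [gzf4, pow_zero, mul_one, one_mul]; rw [div_eq_div_iff (by positivity) (by positivity)]
      ring
  obtain ⟨q, rfl⟩ := exists_X_pow_mul_fin 3 b₃ p hsupp; refine ⟨q, fun t ht => ?_⟩
  obtain ⟨g0, g1, g2, g3, g4, g5, g6, g7, g8, g9, g10, g11, g12, g13⟩ := gz4_denoms_pos ht
  simp only [gzf4, map_mul, map_pow, MvPolynomial.aeval_X, pow_zero, mul_one, one_mul]; rw [div_eq_div_iff (by positivity) (by positivity)]
  ring

/-- **face 2** (`a₂₃`): integrability forces the factor with exponent `a₂₃` to cancel (via `s23`) -/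
theorem face4_2 (p : MvPolynomial (Fin 4) ℚ) (b₀ b₁ b₂ c₀ c₁ c₂ c₃ a₀₁ a₀₂ a₀₃ a₁₂ a₁₃ a₂₃ : ℕ)
    (hint : IntegrableOn (gzf4 p b₀ b₁ b₂ 0 c₀ c₁ c₂ c₃ a₀₁ a₀₂ a₀₃ a₁₂ a₁₃ a₂₃) (KZ.openOrderedSimplex 4)) :
    ∃ p' : MvPolynomial (Fin 4) ℚ, EqOn (gzf4 p b₀ b₁ b₂ 0 c₀ c₁ c₂ c₃ a₀₁ a₀₂ a₀₃ a₁₂ a₁₃ a₂₃) (gzf4 p' b₀ b₁ b₂ 0 c₀ c₁ c₂ c₃ a₀₁ a₀₂ a₀₃ a₁₂ a₁₃ 0) (KZ.openOrderedSimplex 4) := by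
  have hsupp : ∀ e ∈ (s23P p).support, a₂₃ ≤ e 3 := by
    refine face_lemma4 (measurableSet_simplex 4) (fun y hy => (gz4_denoms_pos hy).2.2.2.1.ne')
      (KZ.isOpen_openOrderedSimplex 3) simplex_three_nonempty (fun x => x 2) (fun x hx => snoc_section_four hx)
      (fun x hx => section_base hx)
      (fun u => u 0 ^ b₀ * u 1 ^ b₁ * u 2 ^ b₂ * (1 - u 0) ^ c₀ * (1 - u 1) ^ c₁ * (1 - u 2) ^ c₂ * (1 - (u 2 - u 3)) ^ c₃ * (u 0 - u 1) ^ a₀₁ * (u 0 - u 2) ^ a₀₂ * (u 0 - (u 2 - u 3)) ^ a₀₃ * (u 1 - u 2) ^ a₁₂ * (u 1 - (u 2 - u 3)) ^ a₁₃)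
      (fun x _ => ?_) (fun x hx => ?_) a₂₃ (s23P p)
      ((integrableOn_comp_s23 hint).congr_fun (fun u hu => ?_) (measurableSet_simplex 4))
    · show ContinuousAt (fun s : ℝ => x 0 ^ b₀ * x 1 ^ b₁ * x 2 ^ b₂ * (1 - x 0) ^ c₀ * (1 - x 1) ^ c₁ * (1 - x 2) ^ c₂ * (1 - (x 2 - s)) ^ c₃ * (x 0 - x 1) ^ a₀₁ * (x 0 - x 2) ^ a₀₂ * (x 0 - (x 2 - s)) ^ a₀₃ * (x 1 - x 2) ^ a₁₂ * (x 1 - (x 2 - s)) ^ a₁₃) 0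
      exact (by fun_prop : Continuous fun s : ℝ => x 0 ^ b₀ * x 1 ^ b₁ * x 2 ^ b₂ * (1 - x 0) ^ c₀ * (1 - x 1) ^ c₁ * (1 - x 2) ^ c₂ * (1 - (x 2 - s)) ^ c₃ * (x 0 - x 1) ^ a₀₁ * (x 0 - x 2) ^ a₀₂ * (x 0 - (x 2 - s)) ^ a₀₃ * (x 1 - x 2) ^ a₁₂ * (x 1 - (x 2 - s)) ^ a₁₃).continuousAt
    · obtain ⟨f0, f1, f2, f3, f4, f5, f6, f7, f8⟩ := gz3_denoms_pos hx
      show x 0 ^ b₀ * x 1 ^ b₁ * x 2 ^ b₂ * (1 - x 0) ^ c₀ * (1 - x 1) ^ c₁ * (1 - x 2) ^ c₂ * (1 - (x 2 - (0:ℝ))) ^ c₃ * (x 0 - x 1) ^ a₀₁ * (x 0 - x 2) ^ a₀₂ * (x 0 - (x 2 - (0:ℝ))) ^ a₀₃ * (x 1 - x 2) ^ a₁₂ * (x 1 - (x 2 - (0:ℝ))) ^ a₁₃ ≠ 0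
      have : (0:ℝ) < (1 - x 0) := by linarith
      have : (0:ℝ) < (1 - x 1) := by linarith
      have : (0:ℝ) < (1 - x 2) := by linarith
      have : (0:ℝ) < (1 - (x 2 - (0:ℝ))) := by linarith
      have : (0:ℝ) < (x 0 - x 1) := by linarith
      have : (0:ℝ) < (x 0 - x 2) := by linarith
      have : (0:ℝ) < (x 0 - (x 2 - (0:ℝ))) := by linarith
      have : (0:ℝ) < (x 1 - x 2) := by linarith
      have : (0:ℝ) < (x 1 - (x 2 - (0:ℝ))) := by linarith
      positivity
    · obtain ⟨g0, g1, g2, g3, g4, g5, g6, g7, g8, g9, g10, g11, g12, g13⟩ := gz4_denoms_pos hu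
      have : (0:ℝ) < (1 - u 0) := by linarith
      have : (0:ℝ) < (1 - u 1) := by linarith
      have : (0:ℝ) < (1 - u 2) := by linarith
      have : (0:ℝ) < (1 - (u 2 - u 3)) := by linarith
      have : (0:ℝ) < (u 0 - u 1) := by linarith
      have : (0:ℝ) < (u 0 - u 2) := by linarith
      have : (0:ℝ) < (u 0 - (u 2 - u 3)) := by linarith
      have : (0:ℝ) < (u 1 - u 2) := by linarith
      have : (0:ℝ) < (u 1 - (u 2 - u 3)) := by linarith
      have : (0:ℝ) < (u 2 - (u 2 - u 3)) := by linarith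
      show gzf4 p b₀ b₁ b₂ 0 c₀ c₁ c₂ c₃ a₀₁ a₀₂ a₀₃ a₁₂ a₁₃ a₂₃ (s23 u) = MvPolynomial.aeval u (s23P p) / (u 3 ^ a₂₃ * (u 0 ^ b₀ * u 1 ^ b₁ * u 2 ^ b₂ * (1 - u 0) ^ c₀ * (1 - u 1) ^ c₁ * (1 - u 2) ^ c₂ * (1 - (u 2 - u 3)) ^ c₃ * (u 0 - u 1) ^ a₀₁ * (u 0 - u 2) ^ a₀₂ * (u 0 - (u 2 - u 3)) ^ a₀₃ * (u 1 - u 2) ^ a₁₂ * (u 1 - (u 2 - u 3)) ^ a₁₃))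
      rw [aeval_s23P]; simp only [gzf4, s23_zero, s23_one, s23_two, s23_three, pow_zero, mul_one, one_mul]; rw [div_eq_div_iff (by positivity) (by positivity)]
      ring
  obtain ⟨q, hq⟩ := exists_X_pow_mul_fin 3 a₂₃ (s23P p) hsupp
  have hp : p = (MvPolynomial.X 2 - MvPolynomial.X 3) ^ a₂₃ * s23P q := by
    rw [← s23P_s23P p, hq, map_mul, map_pow]; congr 2; simp [s23P, MvPolynomial.bind₁_X_right, sub_sub_cancel]
  refine ⟨s23P q, fun t ht => ?_⟩
  obtain ⟨g0, g1, g2, g3, g4, g5, g6, g7, g8, g9, g10, g11, g12, g13⟩ := gz4_denoms_pos ht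
  rw [hp]; simp only [gzf4, map_mul, map_pow, map_sub, MvPolynomial.aeval_X, MvPolynomial.aeval_C, map_one, pow_zero, mul_one, one_mul]
  rw [div_eq_div_iff (by positivity) (by positivity)]
  ring

/-- **face 3** (`a₁₂`): integrability forces the factor with exponent `a₁₂` to cancel (via `s13`) -/
theorem face4_3 (p : MvPolynomial (Fin 4) ℚ) (b₀ b₁ b₂ c₀ c₁ c₂ c₃ a₀₁ a₀₂ a₀₃ a₁₂ a₁₃ : ℕ)
    (hint : IntegrableOn (gzf4 p b₀ b₁ b₂ 0 c₀ c₁ c₂ c₃ a₀₁ a₀₂ a₀₃ a₁₂ a₁₃ 0) (KZ.openOrderedSimplex 4)) :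
    ∃ p' : MvPolynomial (Fin 4) ℚ, EqOn (gzf4 p b₀ b₁ b₂ 0 c₀ c₁ c₂ c₃ a₀₁ a₀₂ a₀₃ a₁₂ a₁₃ 0) (gzf4 p' b₀ b₁ b₂ 0 c₀ c₁ c₂ c₃ a₀₁ a₀₂ a₀₃ 0 a₁₃ 0) (KZ.openOrderedSimplex 4) := by
  have hsupp : ∀ e ∈ (s13P p).support, a₁₂ ≤ e 3 := by
    refine face_lemma4 (measurableSet_simplex 4) (fun y hy => (gz4_denoms_pos hy).2.2.2.1.ne')
      (KZ.isOpen_openOrderedSimplex 3) simplex_three_nonempty (fun x => x 2) (fun x hx => snoc_section_four hx)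
      (fun x hx => section_base hx)
      (fun u => u 0 ^ b₀ * u 1 ^ b₁ * (u 1 - u 3) ^ b₂ * (1 - u 0) ^ c₀ * (1 - u 1) ^ c₁ * (1 - (u 1 - u 3)) ^ c₂ * (1 - (u 1 - u 2)) ^ c₃ * (u 0 - u 1) ^ a₀₁ * (u 0 - (u 1 - u 3)) ^ a₀₂ * (u 0 - (u 1 - u 2)) ^ a₀₃ * (u 1 - (u 1 - u 2)) ^ a₁₃)
      (fun x _ => ?_) (fun x hx => ?_) a₁₂ (s13P p)
      ((integrableOn_comp_s13 hint).congr_fun (fun u hu => ?_) (measurableSet_simplex 4))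
    · show ContinuousAt (fun s : ℝ => x 0 ^ b₀ * x 1 ^ b₁ * (x 1 - s) ^ b₂ * (1 - x 0) ^ c₀ * (1 - x 1) ^ c₁ * (1 - (x 1 - s)) ^ c₂ * (1 - (x 1 - x 2)) ^ c₃ * (x 0 - x 1) ^ a₀₁ * (x 0 - (x 1 - s)) ^ a₀₂ * (x 0 - (x 1 - x 2)) ^ a₀₃ * (x 1 - (x 1 - x 2)) ^ a₁₃) 0
      exact (by fun_prop : Continuous fun s : ℝ => x 0 ^ b₀ * x 1 ^ b₁ * (x 1 - s) ^ b₂ * (1 - x 0) ^ c₀ * (1 - x 1) ^ c₁ * (1 - (x 1 - s)) ^ c₂ * (1 - (x 1 - x 2)) ^ c₃ * (x 0 - x 1) ^ a₀₁ * (x 0 - (x 1 - s)) ^ a₀₂ * (x 0 - (x 1 - x 2)) ^ a₀₃ * (x 1 - (x 1 - x 2)) ^ a₁₃).continuousAt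
    · obtain ⟨f0, f1, f2, f3, f4, f5, f6, f7, f8⟩ := gz3_denoms_pos hx
      show x 0 ^ b₀ * x 1 ^ b₁ * (x 1 - (0:ℝ)) ^ b₂ * (1 - x 0) ^ c₀ * (1 - x 1) ^ c₁ * (1 - (x 1 - (0:ℝ))) ^ c₂ * (1 - (x 1 - x 2)) ^ c₃ * (x 0 - x 1) ^ a₀₁ * (x 0 - (x 1 - (0:ℝ))) ^ a₀₂ * (x 0 - (x 1 - x 2)) ^ a₀₃ * (x 1 - (x 1 - x 2)) ^ a₁₃ ≠ 0
      have : (0:ℝ) < (x 1 - (0:ℝ)) := by linarith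
      have : (0:ℝ) < (1 - x 0) := by linarith
      have : (0:ℝ) < (1 - x 1) := by linarith
      have : (0:ℝ) < (1 - (x 1 - (0:ℝ))) := by linarith
      have : (0:ℝ) < (1 - (x 1 - x 2)) := by linarith
      have : (0:ℝ) < (x 0 - x 1) := by linarith
      have : (0:ℝ) < (x 0 - (x 1 - (0:ℝ))) := by linarith
      have : (0:ℝ) < (x 0 - (x 1 - x 2)) := by linarith
      have : (0:ℝ) < (x 1 - (x 1 - x 2)) := by linarith
      positivity
    · obtain ⟨g0, g1, g2, g3, g4, g5, g6, g7, g8, g9, g10, g11, g12, g13⟩ := gz4_denoms_pos hu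
      have : (0:ℝ) < (u 1 - u 3) := by linarith
      have : (0:ℝ) < (1 - u 0) := by linarith
      have : (0:ℝ) < (1 - u 1) := by linarith
      have : (0:ℝ) < (1 - (u 1 - u 3)) := by linarith
      have : (0:ℝ) < (1 - (u 1 - u 2)) := by linarith
      have : (0:ℝ) < (u 0 - u 1) := by linarith
      have : (0:ℝ) < (u 0 - (u 1 - u 3)) := by linarith
      have : (0:ℝ) < (u 0 - (u 1 - u 2)) := by linarith
      have : (0:ℝ) < (u 1 - (u 1 - u 2)) := by linarith
      have : (0:ℝ) < (u 1 - (u 1 - u 3)) := by linarith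
      show gzf4 p b₀ b₁ b₂ 0 c₀ c₁ c₂ c₃ a₀₁ a₀₂ a₀₃ a₁₂ a₁₃ 0 (s13 u) = MvPolynomial.aeval u (s13P p) / (u 3 ^ a₁₂ * (u 0 ^ b₀ * u 1 ^ b₁ * (u 1 - u 3) ^ b₂ * (1 - u 0) ^ c₀ * (1 - u 1) ^ c₁ * (1 - (u 1 - u 3)) ^ c₂ * (1 - (u 1 - u 2)) ^ c₃ * (u 0 - u 1) ^ a₀₁ * (u 0 - (u 1 - u 3)) ^ a₀₂ * (u 0 - (u 1 - u 2)) ^ a₀₃ * (u 1 - (u 1 - u 2)) ^ a₁₃))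
      rw [aeval_s13P]; simp only [gzf4, s13_zero, s13_one, s13_two, s13_three, pow_zero, mul_one, one_mul]; rw [div_eq_div_iff (by positivity) (by positivity)]
      ring
  obtain ⟨q, hq⟩ := exists_X_pow_mul_fin 3 a₁₂ (s13P p) hsupp
  have hp : p = (MvPolynomial.X 1 - MvPolynomial.X 2) ^ a₁₂ * s13P q := by
    rw [← s13P_s13P p, hq, map_mul, map_pow]; congr 2; simp [s13P, MvPolynomial.bind₁_X_right, sub_sub_cancel]
  refine ⟨s13P q, fun t ht => ?_⟩
  obtain ⟨g0, g1, g2, g3, g4, g5, g6, g7, g8, g9, g10, g11, g12, g13⟩ := gz4_denoms_pos ht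
  rw [hp]; simp only [gzf4, map_mul, map_pow, map_sub, MvPolynomial.aeval_X, MvPolynomial.aeval_C, map_one, pow_zero, mul_one, one_mul]
  rw [div_eq_div_iff (by positivity) (by positivity)]
  ring

end Summit.KontsevichZagierPeriods.KontsevichZagierPeriods.Cruxes.GZNormalFormWThree.GZLadder.WlogFour
end
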